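import Literature.Probability.RandomPlanarGeometry.HydrodynamicMaps
import Literature.Probability.RandomPlanarGeometry.PlusHullDisplacement
import Literature.Probability.RandomPlanarGeometry.ArcHullInterior
import Literature.Probability.RandomPlanarGeometry.ArcHullSlits
import HarnessLib

/-!
# The region enclosed by the boundary arc is small in the picture of a late slit

G. F. Lawler, O. Schramm, W. Werner, *Conformal restriction: the chordal case*, J. Amer. Math.
Soc. **16** (2003), proof of Lemma 3.5 (arXiv p. 13): the Loewner chain of the boundary path
`β : [0, s] → ℍ̄` of the smooth hull `E_δ` is run up to the terminal time `s`, at which `β`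
returns to `ℝ` and "`Φ_s = Φ_{E_δ}`" — the region enclosed by `β` and `ℝ` is swallowed. In the
picture of the slit map `E_v = Φ_{β[0,v]}` (`v` close to the end), the remaining piece
`β(v, 1)` of the boundary is a short crosscut of `ℍ` near the real point `E_v(β(1))`, and the
enclosed region `int E_δ` is mapped INSIDE this crosscut. This file PROVES the elementary
topological form of this fact for an arc hull `A` of the tree (`IsArcHull A ∧ IsPlusHull A`,
boundary path `γ`, `ℍ ∩ ∂A = γ(0, 1)`), without the Jordan curve theorem:

* `IsArcHull.diff_slit_eq` — `ℍ ∖ γ[0, v] = (ℍ ∖ A) ∪ int A ∪ γ(v, 1)` for `0 ≤ v < 1`;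
* `IsArcHull.extMap_image_interior_subset_closedBall` — **if `E_v(γ(v, 1)) ⊆ B̄(c, ρ)` (`c` real)
  then `E_v(int A) ⊆ B̄(c, ρ)`**: the far part `{im > 0, |w - c| > ρ}` of `ℍ` is connected
  (`isPreconnected_upperHalfPlane_far`, `HydrodynamicMaps`), misses `E_v(γ(v,1))`, hence lies in
  the disjoint union of the open sets `E_v(ℍ ∖ A)` and `E_v(int A)`, and it meets the former (far
  points are moved by at most `12 r`, `PlusHullDisplacement`), so it lies inside it and misses
  `E_v(int A)`;
* `IsArcHull.closure_extMap_image_diff_subset_closedBall` — consequently the intermediate hull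
  `cl E_v((A ∩ ℍ) ∖ γ[0, v])` between the slit `γ[0, v]` and `A` lies in `B̄(c, ρ)`.

This is what makes the half-plane capacity, the slit maps and the driving function of the
boundary arc continuous at the terminal time.

## References

* [LSW] proof of Lemma 3.5, p. 13 ("`Φ_s = Φ_{E_δ}`") [LawlerSchrammWerner2003Restriction].
* G. F. Lawler, *Conformally Invariant Processes in the Plane* (2005), §4.1 [Lawler2005].
-/

noncomputable section

open Set Filter Metric Complex Function
open _root_.Topology
open UpperHalfPlane (upperHalfPlaneSet isOpen_upperHalfPlaneSet)

namespace Literature.Probability.RandomPlanarGeometry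

section Terminal

variable {A : Set ℂ} (hA : IsArcHull A) (hAp : IsPlusHull A) {γ : ℝ → ℂ}
  (hγc : ContinuousOn γ (Icc 0 1)) (hγi : InjOn γ (Icc 0 1)) (h0 : (γ 0).im = 0)
  (hH : ∀ t ∈ Ioo (0 : ℝ) 1, 0 < (γ t).im) (hfr : upperHalfPlaneSet ∩ frontier A = γ '' Ioo 0 1)

include hA hfr in
/-- `A ∩ ℍ = int A ∪ γ(0, 1)` (`A` is closed, `ℍ ∩ ∂A = γ(0, 1)`, `int A ⊆ ℍ`). [folklore] -/
theorem IsArcHull.inter_upperHalfPlaneSet_eq : A ∩ upperHalfPlaneSet = interior A ∪ γ '' Ioo 0 1 := by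
  have hcl : A = interior A ∪ frontier A := by
    rw [← closure_eq_interior_union_frontier, hA.1.isClosed.closure_eq]
  refine Subset.antisymm ?_ ?_
  · rintro z ⟨hzA, hzH⟩
    rcases hcl.subset hzA with hz | hz
    · exact Or.inl hz
    · right; rw [← hfr]; exact ⟨hzH, hz⟩
  · rintro z (hz | hz)
    · exact ⟨interior_subset hz, hA.1.interior_subset hz⟩
    · have : z ∈ upperHalfPlaneSet ∩ frontier A := by rw [hfr]; exact hz
      exact ⟨frontier_subset_iff_isClosed.2 hA.1.isClosed this.2, this.1⟩

include hA h0 hfr in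
/-- The interior of `A` misses every slit `γ[0, v]`, `v < 1` (its points in `ℍ` are frontier
points). [folklore] -/
theorem IsArcHull.interior_subset_diff_slit {v : ℝ} (hv1 : v < 1) :
    interior A ⊆ upperHalfPlaneSet \ γ '' Icc 0 v := by
  intro z hz
  have hzH : z ∈ upperHalfPlaneSet := hA.1.interior_subset hz
  refine ⟨hzH, ?_⟩
  rintro ⟨t, ht, rfl⟩
  rcases ht.1.lt_or_eq with ht0 | ht0
  · have hfrz : γ t ∈ upperHalfPlaneSet ∩ frontier A := by
      rw [hfr]; exact ⟨t, ⟨ht0, ht.2.trans_lt hv1⟩, rfl⟩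
    exact (disjoint_interior_frontier (s := A)).le_bot ⟨hz, hfrz.2⟩
  · rw [← ht0] at hzH
    have : (0 : ℝ) < (γ 0).im := hzH
    rw [h0] at this
    exact lt_irrefl _ this

include hA hγc hγi h0 hH hfr in
/-- **`ℍ ∖ γ[0, v] = (ℍ ∖ A) ∪ int A ∪ γ(v, 1)`** for `0 ≤ v < 1`. [folklore] -/
theorem IsArcHull.diff_slit_eq {v : ℝ} (hv0 : 0 ≤ v) (hv1 : v < 1) :
    upperHalfPlaneSet \ γ '' Icc 0 v = (upperHalfPlaneSet \ A) ∪ interior A ∪ γ '' Ioo v 1 := by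
  refine Subset.antisymm ?_ ?_
  · rintro z ⟨hzH, hzK⟩
    by_cases hzA : z ∈ A
    · have hz' : z ∈ A ∩ upperHalfPlaneSet := ⟨hzA, hzH⟩
      rw [hA.inter_upperHalfPlaneSet_eq hfr] at hz'
      rcases hz' with hz' | ⟨t, ht, rfl⟩
      · exact Or.inl (Or.inr hz')
      · refine Or.inr ⟨t, ⟨lt_of_not_ge fun hle ↦ hzK ⟨t, ⟨ht.1.le, hle⟩, rfl⟩, ht.2⟩, rfl⟩
    · exact Or.inl (Or.inl ⟨hzH, hzA⟩)
  · rintro z ((hz | hz) | ⟨t, ht, rfl⟩)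
    · exact ⟨hz.1, fun h ↦ hz.2 (hA.slit_subset hγc hfr hv1.le h)⟩
    · exact hA.interior_subset_diff_slit h0 hfr hv1 hz
    · refine ⟨hH t ⟨hv0.trans_lt ht.1, ht.2⟩, ?_⟩
      rintro ⟨s, hs, hst⟩
      have : s = t := hγi ⟨hs.1, hs.2.trans hv1.le⟩ ⟨(hv0.trans_lt ht.1).le, ht.2.le⟩ hst
      rw [this] at hs
      exact absurd hs.2 (not_le.2 ht.1)

include hA hAp hγc hγi h0 hH hfr in
/-- **The enclosed region lies inside the crosscut**: for `0 < v < 1`, if the slit map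
`E_v = E_{γ[0,v]}` sends the rest `γ(v, 1)` of the boundary arc into a disc `B̄(c, ρ)` centred on
the real axis, then it sends the whole interior of `A` into that disc.
[cite: LawlerSchrammWerner2003Restriction, proof of Lemma 3.5 (p. 13), "Φ_s = Φ_{E_δ}"] -/
theorem IsArcHull.extMap_image_interior_subset_closedBall {v : ℝ} (hv0 : 0 < v) (hv1 : v < 1)
    (hne : (γ '' Icc 0 v).Nonempty) {c ρ : ℝ} (hρ : 0 ≤ ρ)
    (hgate : (hA.isPlusHull_slit hAp hγc hγi h0 hH hfr hv0 hv1).extMap hne '' (γ '' Ioo v 1) ⊆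
      closedBall (c : ℂ) ρ) :
    (hA.isPlusHull_slit hAp hγc hγi h0 hH hfr hv0 hv1).extMap hne '' interior A ⊆ closedBall (c : ℂ) ρ := by
  set K : Set ℂ := γ '' Icc 0 v with hK
  have hKp : IsPlusHull K := hA.isPlusHull_slit hAp hγc hγi h0 hH hfr hv0 hv1
  set Φ := hKp.baseMap hne with hΦ
  have hE : ∀ z ∈ upperHalfPlaneSet \ K, hKp.extMap hne z = Φ z := fun z hz ↦ hKp.extMap_of_mem_diff hne hz
  have hKA : K ⊆ A := hA.slit_subset hγc hfr hv1.le
  have hAK : upperHalfPlaneSet \ A ⊆ upperHalfPlaneSet \ K := fun z hz ↦ ⟨hz.1, fun h ↦ hz.2 (hKA h)⟩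
  have hintK : interior A ⊆ upperHalfPlaneSet \ K := hA.interior_subset_diff_slit h0 hfr hv1
  -- the two open images
  set O₁ : Set ℂ := Φ '' (upperHalfPlaneSet \ A) with hO₁
  set O₂ : Set ℂ := Φ '' interior A with hO₂
  have hO₁o : IsOpen O₁ :=
    Φ.isOpen_image_of_isOpen (isOpen_upperHalfPlaneSet.sdiff hA.1.isClosed) hAK
  have hO₂o : IsOpen O₂ := Φ.isOpen_image_of_isOpen isOpen_interior hintK
  have hdisj : Disjoint O₁ O₂ := by
    refine Set.disjoint_left.2 ?_
    rintro _ ⟨z, hz, rfl⟩ ⟨z', hz', heq⟩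
    have : z' = z := Φ.injOn (hintK hz') (hAK hz) heq
    exact hz.2 (this ▸ interior_subset hz')
  -- the far region of `ℍ`
  set O : Set ℂ := {w : ℂ | 0 < w.im ∧ ρ < ‖w - c‖} with hO
  have hOc : IsPreconnected O := isPreconnected_upperHalfPlane_far c ρ hρ
  have hOsub : O ⊆ O₁ ∪ O₂ := by
    rintro w ⟨hwH, hwρ⟩
    obtain ⟨z, hz, rfl⟩ := (hKp.bijOn_extMap hne).surjOn (show w ∈ upperHalfPlaneSet from hwH)
    have hz' := hz
    rw [hK, hA.diff_slit_eq hγc hγi h0 hH hfr hv0.le hv1] at hz'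
    rcases hz' with (hz' | hz') | hz'
    · exact Or.inl ⟨z, hz', (hE z hz).symm⟩
    · exact Or.inr ⟨z, hz', (hE z hz).symm⟩
    · exfalso
      have := hgate (mem_image_of_mem _ hz')
      rw [mem_closedBall, dist_eq_norm] at this
      exact absurd (lt_of_lt_of_le hwρ this) (lt_irrefl _)
  -- a far point of `E_v(ℍ ∖ A)`
  have hO₁ne : (O ∩ O₁).Nonempty := by
    obtain ⟨r, hr, hAr⟩ := hA.exists_subset_closedBall_re_apply_zero (γ := γ)
    have hKr : K ⊆ closedBall (((γ 0).re : ℝ) : ℂ) r := hKA.trans hAr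
    set x₀ : ℝ := (γ 0).re with hx₀
    set R : ℝ := |c| + ρ + 12 * r + r + |x₀| + 1 with hR
    have hR0 : 0 < R := by positivity
    set z : ℂ := (R : ℂ) * Complex.I with hz
    have hzn : ‖z‖ = R := by
      rw [hz, norm_mul, Complex.norm_I, mul_one, Complex.norm_real, Real.norm_of_nonneg hR0.le]
    have hzH : z ∈ upperHalfPlaneSet := by
      show 0 < z.im; simp [hz, hR0]
    have hzA : z ∉ A := fun hzA ↦ by
      have h1 := hAr hzA
      rw [mem_closedBall, dist_eq_norm] at h1
      have h2 : ‖z‖ - ‖(x₀ : ℂ)‖ ≤ ‖z - x₀‖ := norm_sub_norm_le _ _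
      rw [hzn, Complex.norm_real, Real.norm_eq_abs] at h2
      linarith [abs_nonneg c, abs_nonneg x₀]
    have hzU : z ∈ upperHalfPlaneSet \ A := ⟨hzH, hzA⟩
    have hdisp := hKp.norm_extMap_sub_self_le hne hr hKr (hKp.diff_subset_plusDomain (hAK hzU))
    refine ⟨Φ z, ⟨Φ.mapsTo (hAK hzU), ?_⟩, ⟨z, hzU, rfl⟩⟩
    rw [← hE z (hAK hzU)]
    have h3 : ‖z‖ - ‖hKp.extMap hne z - z‖ - ‖(c : ℂ)‖ ≤ ‖hKp.extMap hne z - c‖ := by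
      have := norm_sub_norm_le (hKp.extMap hne z) (c : ℂ)
      have := norm_sub_norm_le z (hKp.extMap hne z - z)
      have h4 : z - (hKp.extMap hne z - z) = 2 * z - hKp.extMap hne z := by ring
      calc ‖z‖ - ‖hKp.extMap hne z - z‖ - ‖(c : ℂ)‖
          ≤ ‖hKp.extMap hne z‖ - ‖(c : ℂ)‖ := by
            have h5 : ‖z‖ ≤ ‖hKp.extMap hne z‖ + ‖hKp.extMap hne z - z‖ := by
              calc ‖z‖ = ‖hKp.extMap hne z - (hKp.extMap hne z - z)‖ := by ring_nf
                _ ≤ ‖hKp.extMap hne z‖ + ‖hKp.extMap hne z - z‖ := norm_sub_le _ _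
            linarith
        _ ≤ ‖hKp.extMap hne z - c‖ := norm_sub_norm_le _ _
    rw [hzn, Complex.norm_real, Real.norm_eq_abs] at h3
    linarith [abs_nonneg x₀]
  -- the far region lies in `E_v(ℍ ∖ A)`, hence misses `E_v(int A)`
  have hOO₁ : O ⊆ O₁ := hOc.subset_left_of_subset_union hO₁o hO₂o hdisj hOsub hO₁ne
  rintro _ ⟨z, hz, rfl⟩
  rw [mem_closedBall, dist_eq_norm, hE z (hintK hz)]
  by_contra hfar
  push Not at hfar
  have hwO : Φ z ∈ O := ⟨Φ.mapsTo (hintK hz), hfar⟩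
  exact Set.disjoint_left.1 hdisj (hOO₁ hwO) ⟨z, hz, rfl⟩

include hA hAp hγc hγi h0 hH hfr in
/-- **The intermediate hull between a late slit and `A` is small**: under the same hypothesis,
`cl E_v((A ∩ ℍ) ∖ γ[0, v]) ⊆ B̄(c, ρ)`. [cite: LawlerSchrammWerner2003Restriction, proof of Lemma 3.5 (p. 13), "Φ_s = Φ_{E_δ}"] -/
theorem IsArcHull.closure_extMap_image_diff_subset_closedBall {v : ℝ} (hv0 : 0 < v) (hv1 : v < 1)
    (hne : (γ '' Icc 0 v).Nonempty) {c ρ : ℝ} (hρ : 0 ≤ ρ)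
    (hgate : (hA.isPlusHull_slit hAp hγc hγi h0 hH hfr hv0 hv1).extMap hne '' (γ '' Ioo v 1) ⊆
      closedBall (c : ℂ) ρ) :
    closure ((hA.isPlusHull_slit hAp hγc hγi h0 hH hfr hv0 hv1).extMap hne ''
      ((A \ γ '' Icc 0 v) ∩ upperHalfPlaneSet)) ⊆ closedBall (c : ℂ) ρ := by
  refine closure_minimal ?_ isClosed_closedBall
  have hset : (A \ γ '' Icc 0 v) ∩ upperHalfPlaneSet = interior A ∪ γ '' Ioo v 1 := by
    ext z
    constructor
    · rintro ⟨⟨hzA, hzK⟩, hzH⟩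
      have : z ∈ upperHalfPlaneSet \ γ '' Icc 0 v := ⟨hzH, hzK⟩
      rw [hA.diff_slit_eq hγc hγi h0 hH hfr hv0.le hv1] at this
      rcases this with (hz | hz) | hz
      · exact absurd hzA hz.2
      · exact Or.inl hz
      · exact Or.inr hz
    · rintro (hz | hz)
      · have h1 := hA.interior_subset_diff_slit h0 hfr hv1 hz
        exact ⟨⟨interior_subset hz, h1.2⟩, h1.1⟩
      · have h1 : z ∈ upperHalfPlaneSet \ γ '' Icc 0 v := by
          rw [hA.diff_slit_eq hγc hγi h0 hH hfr hv0.le hv1]; exact Or.inr hz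
        obtain ⟨t, ht, rfl⟩ := hz
        have hfrz : γ t ∈ upperHalfPlaneSet ∩ frontier A := by
          rw [hfr]; exact ⟨t, ⟨hv0.trans ht.1, ht.2⟩, rfl⟩
        exact ⟨⟨frontier_subset_iff_isClosed.2 hA.1.isClosed hfrz.2, h1.2⟩, h1.1⟩
  rw [hset, image_union]
  exact union_subset (hA.extMap_image_interior_subset_closedBall hAp hγc hγi h0 hH hfr hv0 hv1 hne hρ hgate) hgate

end Terminal

end Literature.Probability.RandomPlanarGeometry
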